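import Mathlib
import HarnessLib
import Literature.Analysis.FluidPDE.ClassicalSolution
import Literature.Analysis.FluidPDE.ClassicalSolutionRegion
import Literature.Analysis.FluidPDE.SelfSimilar
import Literature.Analysis.FluidPDE.HyperbolicDSSOrbit
import Literature.Analysis.FluidPDE.PineauVicolOneSlice
import Literature.Analysis.FluidPDE.TypeIAncientMild
import Summits.NavierStokesRegularity.NavierStokesRegularity.Theorems.QuarterLogPincerFlatWindowDefs
import Summits.NavierStokesRegularity.NavierStokesRegularity.Theorems.QuantisedSymmetryPolyhedralDssProfileExistsStubAncientMildOfClassicalTypeI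

/-!
# Route `QuarterLogPincer` — objects posited by LINE `analytic_window` of crux `TypeIQuantSubcubicExp`
  (item stmt-NavierStokesRegularity-24077): Gevrey-1 profile lines (envelope and mild forms), the one-slice
  threshold with the slice time displayed, and their two-line bookkeeping lemmas

Author of every statement and proof below: **ns-idea-7 g6** (line `analytic_window`, tree copy v4 sha12 `2d3691688f08`;
critics idea-crit-7 g3 BACKSTOP 15:07:08Z + idea-crit-4 g5 PASS 15:22:20Z). Texts VERBATIM (same namespace
`…Cruxes.TypeIQuantSubcubicExp.AnalyticWindow`, same names), only re-homed into an importable module — crux workfiles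
under `Cruxes/…/Lines/` are not importable from `Theorems/`. Landed by ns-tc-p1 g5 (LEAD lineage of 24077) on
DIRECTOR-NS #244 (b), `--supports stmt-NavierStokesRegularity-24077 --as helper`.

* `ProfileGevreyBound C₀ R C₁ θ` — every classical ancient solution of the envelope class `HasTypeIDecay C₀` has, for
  `‖y‖ ≤ R`, smooth profile lines `s ↦ U(s,y)` with `‖∂ₛⁿU‖ ≤ C₁ n!/θⁿ` (`n ≥ 1`);
* `ProfileGevreyBoundMild` — the same over the Oseen-mild class `IsTypeIAncientMild C₀`; `profileGevreyBound_of_mild`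
  (tree `isTypeIAncientMild_of_classical_typeI`, KNSS 2009 Thm 6.1); `accel_of_gevrey` (`‖∂ₛ²U‖ ≤ 2C₁/θ²`);
* `OneSliceThresholdAt Cu δ₀ Cp s₀` — the body of `FlatWindow.OneSliceThreshold` (Pineau–Vicol Thm 1.9) at a given
  annulus-pressure bound and slice parameter; `oneSliceThresholdAt_of`, `OneSliceThresholdAt.mono`.

HONEST FRAMING: a RUNG line on the DSS wall, NEAR-ONE LANE ONLY (barrier `NearOneDssTypeIExclusion`, one-slice
conjunct); it does NOT conclude the crux `TypeIQuantSubcubicExp` (24077), does not narrow S3 `stub_thinCascadeLiouville`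
of `Lines/thin_cascade.lean`, and proves no summit statement; NS regularity is OPEN. The line's only `sorry`, S2a
`stub_slabJets` (class-uniform analyticity jets), is NOT in this file and is keyed to no prover.
-/

noncomputable section

-- the summit-side namespace repeats a component by design (D-0017)
set_option linter.dupNamespace false

namespace Summit.NavierStokesRegularity.NavierStokesRegularity.Cruxes.TypeIQuantSubcubicExp.AnalyticWindow

open MeasureTheory Set Function Filter Topology Metric
open scoped Nat
open Literature.Analysis Literature.Analysis.FluidPDE Literature.Analysis.Calculus
open Summit.NavierStokesRegularity.NavierStokesRegularity.Cruxes.TypeIQuantSubcubicExp.FlatWindow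

/-! ### Objects (verbatim from `Lines/analytic_window.lean` v4) -/


/-- **Gevrey-1 (real-analytic) profile lines on a similarity ball.** Every classical ancient solution in
the envelope class `HasTypeIDecay C₀` has, for every label `‖y‖ ≤ R`, a smooth profile line
`s ↦ U(s,y) = lerayOrbit u s y` with `‖∂ₛⁿU(s,y)‖ ≤ C₁·n!/θⁿ` for all `n ≥ 1` and all `s`
(`θ` = log-time analyticity half-width of the class on the ball, `C₁` = strip bound). -/
def ProfileGevreyBound (C₀ R C₁ θ : ℝ) : Prop :=
  ∀ (u : ℝ → EuclideanSpace ℝ (Fin 3) → EuclideanSpace ℝ (Fin 3)) (p : ℝ → EuclideanSpace ℝ (Fin 3) → ℝ),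
    IsClassicalNSSolutionOn (Iio 0) 1 0 u p → HasTypeIDecay C₀ u →
    ∀ y : EuclideanSpace ℝ (Fin 3), ‖y‖ ≤ R →
      (∀ n : ℕ, ContDiff ℝ n (profileLine u y)) ∧
      ∀ n : ℕ, 1 ≤ n → ∀ s : ℝ, ‖iteratedDeriv n (profileLine u y) s‖ ≤ C₁ * (n ! : ℝ) / θ ^ n

/-- **S2 in mild form (v3; critic P2).** The same Gevrey-1 bounds stated over the Oseen-MILD Type-I ancient
class `IsTypeIAncientMild C₀` (KNSS gauge: joint smoothness on the open past, `div u = 0`, the Oseen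
representation `u(t) = e^{(t−s)Δ}u(s) − B_s(u,u)(t)` between all `s < t < 0`, temporal bound `‖u(t,x)‖ ≤ C₀/√(−t)`)
— the class on which the tree's analyticity facts act (`IsTypeIAncientMild.analyticOnNhd_slice_univ`,
Lemarié-Rieusset Thm 9.12; Dong–Zhang for time).  The envelope class maps into it by the TREE theorem
`isTypeIAncientMild_of_classical_typeI` (KNSS 2009 Thm 6.1 mildness clause), see `profileGevreyBound_of_mild`:
the «classical ⇒ mild» step is discharged BY NAME and the open stub is pure analysis of mild solutions. -/
def ProfileGevreyBoundMild (C₀ R C₁ θ : ℝ) : Prop :=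
  ∀ (u : ℝ → EuclideanSpace ℝ (Fin 3) → EuclideanSpace ℝ (Fin 3)), IsTypeIAncientMild C₀ u →
    ∀ y : EuclideanSpace ℝ (Fin 3), ‖y‖ ≤ R →
      (∀ n : ℕ, ContDiff ℝ n (profileLine u y)) ∧
      ∀ n : ℕ, 1 ≤ n → ∀ s : ℝ, ‖iteratedDeriv n (profileLine u y) s‖ ≤ C₁ * (n ! : ℝ) / θ ^ n

/-- Mild form ⇒ envelope-class form, by the tree's `isTypeIAncientMild_of_classical_typeI` (KNSS 2009 Thm 6.1). -/
theorem profileGevreyBound_of_mild {C₀ R C₁ θ : ℝ} (h : ProfileGevreyBoundMild C₀ R C₁ θ) :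
    ProfileGevreyBound C₀ R C₁ θ := fun u _p hsol hdec y hy =>
  h u (Summit.NavierStokesRegularity.NavierStokesRegularity.Theorems.PolyhedralDssProfileExists.Birth.isTypeIAncientMild_of_classical_typeI
    hsol hdec) y hy

/-- Gevrey data certify an acceleration constant on the inspected ball: `‖∂ₛ²U(s,y)‖ ≤ 2C₁/θ²` for `‖y‖ ≤ R`
(the comparison point `B_G` of `window_comparison`). -/
theorem accel_of_gevrey {C₀ R C₁ θ : ℝ} (h : ProfileGevreyBound C₀ R C₁ θ)
    {u : ℝ → EuclideanSpace ℝ (Fin 3) → EuclideanSpace ℝ (Fin 3)} {p : ℝ → EuclideanSpace ℝ (Fin 3) → ℝ}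
    (hsol : IsClassicalNSSolutionOn (Iio 0) 1 0 u p) (hdec : HasTypeIDecay C₀ u)
    {y : EuclideanSpace ℝ (Fin 3)} (hy : ‖y‖ ≤ R) (s : ℝ) :
    ‖iteratedDeriv 2 (profileLine u y) s‖ ≤ 2 * C₁ / θ ^ 2 := by
  have h2 := (h u p hsol hdec y hy).2 2 (by norm_num) s
  have e : C₁ * ((2 : ℕ)! : ℝ) / θ ^ 2 = 2 * C₁ / θ ^ 2 := by simp [Nat.factorial]; ring
  rwa [e] at h2

/-- **One-slice threshold with the slice time displayed** — the body of `FlatWindow.OneSliceThreshold`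
(Pineau–Vicol Thm 1.9 with threshold `δ₀`) at a given annulus-pressure bound `Cp` and slice parameter `s₀`:
flatness `‖pvSliceDefect‖ ≤ δ₀` on `B₁` at one time `t̄ ∈ (−e^{−s₀}, 0)` makes the apex regular. -/
def OneSliceThresholdAt (Cu δ₀ Cp s₀ : ℝ) : Prop :=
  ∀ (u : ℝ → EuclideanSpace ℝ (Fin 3) → EuclideanSpace ℝ (Fin 3)) (p : ℝ → EuclideanSpace ℝ (Fin 3) → ℝ),
    IsClassicalNSSolutionOnRegion pvRegion 1 0 u p →
    (∀ t ∈ Ico (-1 : ℝ) 0, ∀ x ∈ ball (0 : EuclideanSpace ℝ (Fin 3)) 1, ‖u t x‖ ≤ Cu / (Real.sqrt (-t) + ‖x‖)) →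
    (∀ t ∈ Ico (-1 : ℝ) 0, ∀ x : EuclideanSpace ℝ (Fin 3), 1 / 2 < ‖x‖ → ‖x‖ < 3 / 4 → |p t x| ≤ Cp) →
    ∀ tbar : ℝ, -Real.exp (-s₀) < tbar → tbar < 0 →
      (∀ x ∈ ball (0 : EuclideanSpace ℝ (Fin 3)) 1, ‖pvSliceDefect u tbar x‖ ≤ δ₀) →
      ∃ r : ℝ, 0 < r ∧ ∃ M : ℝ, ∀ t : ℝ, -r ^ 2 < t → t < 0 → ∀ x ∈ ball (0 : EuclideanSpace ℝ (Fin 3)) r, ‖u t x‖ ≤ M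

/-! ### The obligations: S1 (PROVED in v2 below, `gevreyFlatness_holds`) and S2 (the one open stub) -/

/-! ### Bookkeeping around Pineau–Vicol's threshold (verbatim) -/


/-- The tree's one-slice threshold, with the slice parameter `s₀` exposed. -/
theorem oneSliceThresholdAt_of {Cu δ₀ Cp : ℝ} (hT : OneSliceThreshold Cu δ₀) (hCp : 0 < Cp) :
    ∃ s₀ : ℝ, 1 ≤ s₀ ∧ OneSliceThresholdAt Cu δ₀ Cp s₀ := by
  obtain ⟨s₀, hs₀, h⟩ := hT.2 Cp hCp
  exact ⟨s₀, hs₀, fun u p hreg henv hpb tbar h1 h2 hflat => h u p hreg henv hpb tbar h1 h2 hflat⟩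

/-- A smaller threshold is still a threshold. -/
theorem OneSliceThresholdAt.mono {Cu δ₀ δ₀' Cp s₀ : ℝ} (h : OneSliceThresholdAt Cu δ₀ Cp s₀) (hle : δ₀' ≤ δ₀) :
    OneSliceThresholdAt Cu δ₀' Cp s₀ :=
  fun u p hreg henv hpb tbar h1 h2 hflat => h u p hreg henv hpb tbar h1 h2 fun x hx => (hflat x hx).trans hle


end Summit.NavierStokesRegularity.NavierStokesRegularity.Cruxes.TypeIQuantSubcubicExp.AnalyticWindow

end
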